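import Mathlib.Data.Nat.Bitwise
import Mathlib.Data.List.Basic

/-!
# ZC-2 kernel certificate: the class-regular STD₄[12;3] has no regular double cover that is an STD₂[12;6]
Framing: lottery ticket; floor = certified bounds/negative ranges.

Cell pub-namedobj (target M, family F-INV2 / ZCOVER, designs g5; HOME FAMILY-ZCOVER.md). `A` below is a generalized Hadamard
matrix GH(12, Z₃) (additive notation; designs-g4 normal form `code/std4/gh12_3.json`, sha256 b5506c70…; re-checked here by
`isGH`). D(A) is its class-regular symmetric transversal design STD₄[12;3] (point `(i,x)` on block `(j, x + A i j)`, `x ∈ Z₃`),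
the unique STD₄[12;3] up to isomorphism (Suetake, Des. Codes Cryptogr. 37 (2005) 293–304). A regular double cover of D(A) is a
Z₂-voltage `φ` on the 432 flags; flag `(i,j,x)` is bit number `v(i,j,x) = (12 i + j)·3 + x` of a natural number (bitset). The
cover D(A,φ) (points `(i,x,s)`, blocks `(j,c,t)`, `s,t ∈ Z₂`; incidence `c = x + A i j ∧ t = s + φ(i,j,x)`) is an STD₂[12;6]
iff each of the 1188 constraints `allCons` (594 point-pair + 594 block-pair constraints, four flag pairs each) has EXACTLY TWO
pairs with different bits (`twoOfFour`). Every STD₂[12;6] with an automorphism of order 2 fixing all point classes and all block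
classes is such a cover (FAMILY-ZCOVER §1), and sheet relabelings give the normalisation `φ(0,j,x) = φ(i,0,x) = 0` (`normVars`).

WHAT THE KERNEL EVALUATES (`decide +kernel`; axioms standard; no `native_decide`) — the decision procedure of engine E1
(code/std5/covers.py), re-implemented on `Nat` bitsets so that GMP-backed kernel arithmetic does the work:
* the PARITY SHADOW (two-of-four ⟹ the eight flag bits of a constraint have even weight) plus the 69 normalisation units is a
  GF(2)-linear system of 1257 rows in 432 unknowns; `gjLoop` runs Gauss–Jordan elimination on it with all rows packed into one
  natural number (row `r` in bits `[432 r, 432 r + 432)`), clearing a pivot column in every row at once by one multiplication;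
* `certOK`: the elimination consumed every row (`M = 0`), produced reduced pivot rows (`P_v ∧ pivots = {v}`, `P_v < 2^432`) and
  left exactly the nine free bits `freeExpected` (essential dimension 7 + 2 residual gauge, as E1/E1b found);
* `cosetsOK`: each of the 2⁹ = 512 parity solutions `coset b` spanned by the kernel basis read off the pivot rows violates a
  two-of-four constraint.
Soundness of the checker (referee-readable; a Lean proof of it is successor work): every `gjLoop` step XORs one current row into
other rows, so pivot rows are GF(2)-combinations of input rows; hence any normalised φ satisfying all parity constraints satisfies
`P_v · φ = 0`, i.e. `φ_v = Σ_{f free} P_v[f] φ_f`, i.e. `φ = coset b` for `b` = its free bits; and two-of-four implies parity. So: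
NO normalised φ makes D(A,φ) an STD₂[12;6]; with FAMILY-ZCOVER §1 and Suetake 2005, no STD₂[12;6] admits a class-fixing
involution, and in particular there is no generalized Hadamard matrix of order 12 over a group of order 6 ('GH(6,2)', listed as
the smallest unsettled case of de Launey's table in Horadam, Hadamard Matrices and Their Applications (2007), p. 113). Two Python
engines (E1; E1b certificate checker, no shared code) agree with this kernel evaluation (128 gauge classes = 512 normalised cosets).
-/

namespace Summit.Ventures.DiscreteObjects.STD.ZC2

/-- the GH(12, Z₃) `A` (rows = point classes, columns = block classes, entries in {0,1,2}) -/
def ghA : List (List Nat) :=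
  [[0, 0, 0, 0, 0, 0, 0, 0, 0, 0, 0, 0],
   [0, 0, 0, 0, 1, 1, 1, 1, 2, 2, 2, 2],
   [0, 0, 0, 1, 0, 2, 2, 2, 1, 1, 1, 2],
   [0, 0, 1, 2, 2, 0, 1, 2, 0, 1, 2, 1],
   [0, 1, 0, 2, 2, 1, 2, 0, 2, 0, 1, 1],
   [0, 1, 2, 0, 1, 2, 0, 2, 0, 2, 1, 1],
   [0, 1, 2, 1, 2, 0, 0, 1, 2, 1, 0, 2],
   [0, 1, 2, 2, 0, 2, 1, 1, 1, 0, 2, 0],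
   [0, 2, 1, 0, 2, 0, 2, 1, 1, 2, 1, 0],
   [0, 2, 1, 1, 0, 2, 1, 0, 2, 2, 0, 1],
   [0, 2, 1, 2, 1, 1, 0, 2, 1, 0, 0, 2],
   [0, 2, 2, 1, 1, 1, 2, 0, 0, 1, 2, 0]]

/-- entry `A i j` -/
def aA (i j : Nat) : Nat := (ghA.getD i []).getD j 0

/-- `A` is a GH(12, Z₃): differences of two distinct rows, and of two distinct columns, take each value of Z₃ four times -/
def isGH : Bool :=
  ((List.range 12).all fun i => (List.range 12).all fun i' => (i == i') ||
    ((List.range 3).all fun d => ((List.range 12).filter fun j => (aA i j + 3 - aA i' j) % 3 == d).length == 4))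
  && ((List.range 12).all fun j => (List.range 12).all fun j' => (j == j') ||
    ((List.range 3).all fun d => ((List.range 12).filter fun i => (aA i j + 3 - aA i j') % 3 == d).length == 4))

/-- bit number of the flag `(i,j,x)` -/
def vIdx (i j x : Nat) : Nat := (12 * i + j) * 3 + x

/-- the 594 point-pair constraints: points `(i,x)`, `(i',x')`, `i < i'`, meet in the four block classes `j` with
`x + A i j = x' + A i' j (mod 3)`; flag pairs `((i,j,x),(i',j,x'))` -/
def primalCons : List (List (Nat × Nat)) :=
  (List.range 12).flatMap fun i => (List.range 12).flatMap fun i' =>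
    if i < i' then
      (List.range 3).flatMap fun x => (List.range 3).map fun x' =>
        ((List.range 12).filter fun j => (x + aA i j) % 3 == (x' + aA i' j) % 3).map fun j => (vIdx i j x, vIdx i' j x')
    else []

/-- the 594 block-pair constraints: blocks `(j,c)`, `(j',c')`, `j < j'`, meet in the four point classes `i` whose point on `(j,c)`,
`x = c − A i j`, also lies on `(j',c')`; flag pairs `((i,j,x),(i,j',x))` -/
def dualCons : List (List (Nat × Nat)) :=
  (List.range 12).flatMap fun j => (List.range 12).flatMap fun j' =>
    if j < j' then
      (List.range 3).flatMap fun c => (List.range 3).map fun c' =>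
        ((List.range 12).filter fun i => ((c + 3 - aA i j) % 3 + aA i j') % 3 == c' % 3).map fun i =>
          (vIdx i j ((c + 3 - aA i j) % 3), vIdx i j' ((c + 3 - aA i j) % 3))
    else []

/-- all 1188 STD₂[12;6] constraints on a double cover of D(A) -/
def allCons : List (List (Nat × Nat)) := primalCons ++ dualCons

/-- the 69 normalised flags `φ(0,j,x) = 0`, `φ(i,0,x) = 0` -/
def normVars : List Nat :=
  ((List.range 12).flatMap fun j => (List.range 3).map fun x => vIdx 0 j x)
  ++ ((List.range 11).flatMap fun i => (List.range 3).map fun x => vIdx (i + 1) 0 x)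

/-- the flag pair has different bits in the voltage bitset `m` -/
def diffBit (m : Nat) (p : Nat × Nat) : Bool := xor (m.testBit p.1) (m.testBit p.2)

/-- exactly two of the four flag pairs of the constraint differ -/
def twoOfFour (m : Nat) (c : List (Nat × Nat)) : Bool := (c.countP fun p => diffBit m p) == 2

/-- D(A, φ_m) satisfies all STD₂[12;6] constraints -/
def isSTD2cover (m : Nat) : Bool := allCons.all (twoOfFour m)

/-- parity mask of a constraint: XOR of `2^a ^^^ 2^b` over its flag pairs -/
def maskOf : List (Nat × Nat) → Nat
  | [] => 0
  | p :: l => (2 ^ p.1 ^^^ 2 ^ p.2) ^^^ maskOf l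

/-- the 1257 rows of the linear system: 1188 parity masks, then 69 normalisation units -/
def inputRows : List Nat := allCons.map maskOf ++ normVars.map fun v => 2 ^ v

/-- row width of the packed matrix -/
def W : Nat := 432

/-- number of rows -/
def R : Nat := 1257

/-- all rows packed into one number: row `r` occupies bits `[W r, W r + W)` -/
def packedRows : Nat := (inputRows.foldl (fun (acc : Nat × Nat) row => (acc.1 ||| (row <<< acc.2), acc.2 + W)) (0, 0)).1

/-- `Σ_{r<n} 2^{W r}`: bit 0 of every row block -/
def strideOnes (n : Nat) : Nat := (2 ^ (W * n) - 1) / (2 ^ W - 1)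

/-- one Gauss–Jordan step at bit position `v` on the state `(M, Piv, PV)`: `M` = rows not yet used as pivots, `Piv` = pivot rows
(the row with pivot `u` stored in block `u`), `PV` = bitset of pivot positions. If some row of `M` has bit `v`: take the lowest
such row `P`, XOR it into every row of `M` having bit `v` (this also deletes `P` from `M`) and into every pivot row having bit
`v`, then store `P` as the pivot row of `v`. -/
def gjStep (v : Nat) (st : Nat × Nat × Nat) : Nat × Nat × Nat :=
  let M := st.1
  let S := M &&& (strideOnes R <<< v)
  bif S == 0 then st else
    -- lowest set bit of `S` is `2^(W r + v)` for the lowest row `r` having bit `v`; `((S ^^^ (S-1)) + 1) / 2` is that power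
    -- of two, and dividing `M` by `2^(W r)` brings row `r` down to block 0 (only +,-,xor,/,&&& : kernel-accelerated arithmetic)
    let P := (M / ((((S ^^^ (S - 1)) + 1) / 2) >>> v)) &&& (2 ^ W - 1)
    let Sp := st.2.1 &&& (strideOnes W <<< v)
    (M ^^^ P * (S >>> v), (st.2.1 ^^^ P * (Sp >>> v)) ||| (P <<< (W * v)), st.2.2 ||| 2 ^ v)

/-- Gauss–Jordan over the bit positions `v, v+1, …` (fuel-bounded) -/
def gjLoop : Nat → Nat → Nat × Nat × Nat → Nat × Nat × Nat
  | 0, _, st => st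
  | fuel + 1, v, st => gjLoop fuel (v + 1) (gjStep v st)

/-- final elimination state -/
def gjFinal : Nat × Nat × Nat := gjLoop 432 0 (packedRows, 0, 0)

/-- pivot row of position `v` (zero if `v` is free) -/
def pivotRow (v : Nat) : Nat := (gjFinal.2.1 >>> (W * v)) &&& (2 ^ W - 1)

/-- bitset of pivot positions -/
def pivotSet : Nat := gjFinal.2.2

/-- the free positions found by E1/E1b (essential dimension 7 + 2 residual gauge bits) -/
def freeExpected : List Nat := [386, 392, 395, 416, 422, 425, 426, 427, 428]

/-- CERTIFICATE CHECK of the elimination: every input row consumed, the free positions are exactly `freeExpected`, and every pivot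
row is reduced (`< 2^432`, meets the pivot set only in its own position) -/
def certOK : Bool :=
  (gjFinal.1 == 0)
  && (pivotSet == (2 ^ 432 - 1) ^^^ (freeExpected.foldl (fun acc f => acc ||| 2 ^ f) 0))
  && (List.range 432).all fun v => freeExpected.elem v ||
       ((pivotRow v < 2 ^ 432) && ((pivotRow v &&& pivotSet) == 2 ^ v))

/-- kernel basis vector of the free position `f`: `f` itself and every pivot whose reduced row involves `f` -/
def basisVec (f : Nat) : Nat :=
  (List.range 432).foldl (fun acc v => bif (pivotRow v).testBit f && !(freeExpected.elem v) then acc ^^^ 2 ^ v else acc) (2 ^ f)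

/-- the nine basis vectors -/
def basis : List Nat := freeExpected.map basisVec

/-- XOR of the basis vectors selected by the bits of `b` -/
def cosetOf : List Nat → Nat → Nat → Nat
  | [], _, _ => 0
  | q :: l, b, k => (bif b.testBit k then q else 0) ^^^ cosetOf l b (k + 1)

/-- the normalised parity solution with free bits `b` -/
def coset (b : Nat) : Nat := cosetOf basis b 0

/-- every one of the 512 normalised parity solutions violates an STD₂[12;6] constraint -/
def cosetsOK : Bool := (List.range 512).all fun b => !(isSTD2cover (coset b))

/-- sanity of the data: `A` is a GH(12, Z₃); 1188 constraints of four flag pairs each, all flags below 432; 1257 rows -/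
theorem data_ok : (isGH && (allCons.length == 1188) && (inputRows.length == R) &&
    (allCons.all fun c => (c.length == 4) && c.all fun p => decide (p.1 < 432) && decide (p.2 < 432))) = true := by
  decide +kernel

/-- **ZC-2, elimination leg (kernel):** the in-kernel Gauss–Jordan elimination of the normalised parity system is complete and
reduced with exactly the nine free positions `freeExpected`. -/
theorem cert_ok : certOK = true := by
  decide +kernel

/-- **ZC-2, enumeration leg (kernel):** all 512 normalised parity solutions fail the STD₂[12;6] two-of-four axioms; with
`cert_ok`: the STD₄[12;3] D(A) has no regular double cover that is an STD₂[12;6]. -/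
theorem cosets_ok : cosetsOK = true := by
  decide +kernel

end Summit.Ventures.DiscreteObjects.STD.ZC2

/-! ## Literature note (appended 2026-08-20, designs g5; wording ruling of the cell lead 20:23Z)
The corollary "no generalized Hadamard matrix of order 12 over Z₆" stated in the header above RE-DERIVES a published result:
P. Lampio, *Classification of difference matrices and complex Hadamard matrices*, Aalto University doctoral dissertation (2015),
Table 6.1 and p. 123 (difference matrices over Z₆ with 12 columns have at most 6 rows), reportedly already in Lampio–Östergård,
J. Statist. Plann. Inference 141 (2011) 1194–1207; Horadam 2007's "GH(6,2) unsettled" is superseded for the abelian group.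
So for Z₆ this file is an agreeing replication (a control of the method against print). Not found in print, hence provisional
pending Suetake, J. Stat. Theory Pract. 3 (2009) (paywalled): the non-abelian case "no GH(12, S₃)" and the STD-level statement
proved here (no normalised regular double cover of the STD₄[12;3]; with Suetake 2005: no STD₂[12;6] admits a class-fixing
involution). -/
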